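import Summits.Ventures.YMGap.RobustBall.TruncationConvergenceS
import Summits.Ventures.YMGap.RobustBall.DirectionalSusceptibilityS
import Summits.Ventures.YMGap.RobustBall.TruncatedSeriesDerivative
import Summits.Ventures.YMGap.RobustBall.LocalSourceResponse
import Summits.Ventures.YMGap.Thresholds.CouplingContDiff
import HarnessLib

/-!
# Venture YMGap, track ROBUST-BALL (Y2) — TIER 2: THE STATE IS `C¹` ALONG EVERY DIRECTION OF THE OPEN WEIGHTED BALL, WITH DERIVATIVE THE
# SUSCEPTIBILITY SERIES — EXACT LINEAR RESPONSE `d/ds ⟨F⟩_{W+sV} = −Σ_X cov_{W+sV}(F, V_X)` ON THE WHOLE BALL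

HONEST FRAMING. WHAT THIS IS: a venture file (cell `pub-ymgap`, track Y2 ROBUST-BALL, seat rb-p1, theorems only).  Member `W ∈ Ball(a, Λ, t)`,
direction `V ∈ Ball(a_V, Λ_V, t)` with total Frobenius-Lipschitz load `≤ L` through every link, `a + s₀ a_V ≤ a'`, `Λ + s₀ Λ_V ≤ Λ'`, pair door
`ρ' := 6(d−1)|β| e^{a'} e^{t} √(cv) + e^{a'/2} √c Λ'_t < 1`, `t > 0`.  Then for EVERY selection `ν(s) ∈ 𝒢(W + sV)` (`|s| ≤ s₀`; the state is
unique there) and every bounded local Frobenius-Lipschitz observable `F`: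
* ★ `hasDerivAt_and_continuousOn_direction_S` — (i) `s ↦ ⟨F⟩_{ν(s)}` is DIFFERENTIABLE at every `|s| < s₀` with derivative
  `−Σ'_X cov_{ν(s)}(F, V_X)`, the absolutely convergent susceptibility series of `DirectionalSusceptibilityS.lean`, and (ii) that series is
  CONTINUOUS in `s` on `|s| ≤ s₀`; `contDiffOn_integral_direction_S` — hence `ContDiffOn ℝ 1` on `(−s₀, s₀)`: the infinite-volume state responds
  LINEARLY, to first order, to every direction of the Banach ball — plaquette couplings, anisotropies, improvement terms, loops of every size,
  pair couplings, … — with the fluctuation–dissipation formula, and no first-order transition is met along any line inside the ball.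
  Mechanism: local Feynman–Hellmann on the truncated lines `W + s·𝟙_{T_n}V` (`LocalSourceResponse`, Föllmer's tilt identity), uniform
  convergence of states along truncations (`TruncationConvergenceS`, screened stability), one summable majorant for all covariances
  (`DirectionalSusceptibilityS`), uniform limits of derivatives (`TruncatedSeriesDerivative`), `CouplingContDiff.contDiffOn_one_of_hasDerivAt`;
* `tendstoUniformlyOn_cov` — bookkeeping: covariances converge uniformly when the three moments do;
* `su2_hasDerivAt_integral_direction_dim4` — `SU(2)`, `ℤ⁴`, hypothesis-free (`6|β_W| e^{a'} e^{t} + e^{a'/2} √(2/3) Λ' < 1`);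
  `su2_wilson_hasDerivAt_integral_direction` — the Wilson point in every direction of the weighted ball.
WHAT THIS IS NOT: `C¹` along lines (Gâteaux) — analyticity and a Fréchet statement on the Banach space are NOT claimed; one-sided Dobrushin
technology at lattice strong coupling; nothing about the continuum limit or a Clay-sense mass gap.  ds-1's `CouplingDerivative.lean` is the
Wilson-plaquette direction at the Wilson point via torus limits; here: every direction, every member, directly in infinite volume.
-/

noncomputable section

open MeasureTheory Function Finset ProbabilityTheory Real Filter Topology
open scoped NNReal
open Literature.Probability.LatticeModels
open Literature.Probability.LatticeModels.DobrushinMetric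
open Literature.MathematicalPhysics.QuantumLattice
open Literature.MathematicalPhysics.QuantumFieldTheory hiding ZdEdge
open Summit.QuantumFields.BalabanUV.InfraRed.StrongCouplingPoincareDoorSUN (oneLinkPoincareSUN_two_sharp)

namespace Summit.Ventures.YMGap.RobustBall

variable {d N : ℕ}

/-! ### Bookkeeping: products and covariances -/

/-- Coordinatewise Lipschitz bounds of a product of bounded functions (`r ≥ 0`, bounds `Mf, Mg ≥ 0`). -/
theorem isLipBound_mul_of_abs_le {V S : Type*} {r : S → S → ℝ} (hr : ∀ a b, 0 ≤ r a b) {f g : (V → S) → ℝ} {Mf Mg : ℝ}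
    (hMf0 : 0 ≤ Mf) (hMg0 : 0 ≤ Mg) (hMf : ∀ σ, |f σ| ≤ Mf) (hMg : ∀ σ, |g σ| ≤ Mg) {δf δg : V → ℝ}
    (hf : IsLipBound r f δf) (hg : IsLipBound r g δg) :
    IsLipBound r (fun σ => f σ * g σ) (fun y => Mf * δg y + Mg * δf y) := by
  refine ⟨fun y => add_nonneg (mul_nonneg hMf0 (hg.nonneg y)) (mul_nonneg hMg0 (hf.nonneg y)), fun y σ τ hστ => ?_⟩
  have h1 : |f σ| * |g σ - g τ| ≤ Mf * (δg y * r (σ y) (τ y)) :=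
    (mul_le_mul_of_nonneg_left (hg.le y σ τ hστ) (abs_nonneg _)).trans
      (mul_le_mul_of_nonneg_right (hMf σ) (mul_nonneg (hg.nonneg y) (hr _ _)))
  have h2 : |f σ - f τ| * |g τ| ≤ δf y * r (σ y) (τ y) * Mg :=
    (mul_le_mul_of_nonneg_left (hMg τ) (abs_nonneg _)).trans
      (mul_le_mul_of_nonneg_right (hf.le y σ τ hστ) hMg0)
  calc |f σ * g σ - f τ * g τ| = |f σ * (g σ - g τ) + (f σ - f τ) * g τ| := by ring_nf
    _ ≤ |f σ * (g σ - g τ)| + |(f σ - f τ) * g τ| := abs_add_le _ _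
    _ = |f σ| * |g σ - g τ| + |f σ - f τ| * |g τ| := by rw [abs_mul, abs_mul]
    _ ≤ Mf * (δg y * r (σ y) (τ y)) + δf y * r (σ y) (τ y) * Mg := add_le_add h1 h2
    _ = (Mf * δg y + Mg * δf y) * r (σ y) (τ y) := by ring

/-- A product of functions depending on `Δf`, `Δg` depends on `Δf ∪ Δg`. -/
theorem dependsOn_mul_union {V S : Type*} [DecidableEq V] {f g : (V → S) → ℝ} {Δf Δg : Finset V}
    (hf : DependsOn f (↑Δf : Set V)) (hg : DependsOn g (↑Δg : Set V)) :
    DependsOn (fun σ => f σ * g σ) (↑(Δf ∪ Δg) : Set V) := fun σ τ h => by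
  show f σ * g σ = f τ * g τ
  rw [hf (fun y hy => h y (by simp [Finset.mem_coe.1 hy])), hg (fun y hy => h y (by simp [Finset.mem_coe.1 hy]))]

/-- The absolute value of the integral of a function bounded by `M` against a probability measure is `≤ M`. -/
theorem abs_integral_le_of_abs_le {Ω : Type*} [MeasurableSpace Ω] {μ : Measure Ω} [IsProbabilityMeasure μ] {g : Ω → ℝ} {M : ℝ}
    (hM : ∀ σ, |g σ| ≤ M) : |∫ σ, g σ ∂μ| ≤ M := by
  have h := norm_integral_le_of_norm_le_const (μ := μ) (f := g) (C := M) (Eventually.of_forall fun σ => by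
    rw [Real.norm_eq_abs]; exact hM σ)
  rwa [Real.norm_eq_abs, probReal_univ, mul_one] at h

/-- **Covariances converge uniformly when the three moments do** (probability measures, bounded integrands). -/
theorem tendstoUniformlyOn_cov {Ω : Type*} [MeasurableSpace Ω] {νn : ℕ → ℝ → Measure Ω} {ν : ℝ → Measure Ω} {I : Set ℝ}
    (hνn : ∀ n, ∀ s ∈ I, IsProbabilityMeasure (νn n s)) (hν : ∀ s ∈ I, IsProbabilityMeasure (ν s))
    {f g : Ω → ℝ} (hfm : Measurable f) (hgm : Measurable g) {Mf Mg : ℝ} (hMf0 : 0 ≤ Mf) (hMg0 : 0 ≤ Mg)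
    (hMf : ∀ σ, |f σ| ≤ Mf) (hMg : ∀ σ, |g σ| ≤ Mg)
    (h1 : TendstoUniformlyOn (fun n s => ∫ σ, f σ ∂(νn n s)) (fun s => ∫ σ, f σ ∂(ν s)) atTop I)
    (h2 : TendstoUniformlyOn (fun n s => ∫ σ, g σ ∂(νn n s)) (fun s => ∫ σ, g σ ∂(ν s)) atTop I)
    (h3 : TendstoUniformlyOn (fun n s => ∫ σ, f σ * g σ ∂(νn n s)) (fun s => ∫ σ, f σ * g σ ∂(ν s)) atTop I) :
    TendstoUniformlyOn (fun n s => cov[f, g; νn n s]) (fun s => cov[f, g; ν s]) atTop I := by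
  -- `cov = ∫fg − ∫f ∫g` on both sides
  have hcov : ∀ (μ : Measure Ω), IsProbabilityMeasure μ → cov[f, g; μ] = (∫ σ, f σ * g σ ∂μ) - (∫ σ, f σ ∂μ) * ∫ σ, g σ ∂μ :=
    fun μ hμ => by
      have hf2 : MemLp f 2 μ :=
        MemLp.of_bound hfm.aestronglyMeasurable Mf (Eventually.of_forall fun σ => by rw [Real.norm_eq_abs]; exact hMf σ)
      have hg2 : MemLp g 2 μ :=
        MemLp.of_bound hgm.aestronglyMeasurable Mg (Eventually.of_forall fun σ => by rw [Real.norm_eq_abs]; exact hMg σ)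
      rw [covariance_eq_sub hf2 hg2]; rfl
  rw [Metric.tendstoUniformlyOn_iff] at h1 h2 h3 ⊢
  intro ε hε
  have hε₁ : 0 < ε / (3 * (Mg + 1)) := by positivity
  have hε₂ : 0 < ε / (3 * (Mf + 1)) := by positivity
  filter_upwards [h1 _ hε₁, h2 _ hε₂, h3 _ (by positivity : 0 < ε / 3)] with n hn1 hn2 hn3 s hs
  haveI := hνn n s hs
  haveI := hν s hs
  have e1 := hn1 s hs; have e2 := hn2 s hs; have e3 := hn3 s hs
  rw [Real.dist_eq] at e1 e2 e3 ⊢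
  rw [hcov _ (hνn n s hs), hcov _ (hν s hs)]
  set A := ∫ σ, f σ ∂(ν s); set An := ∫ σ, f σ ∂(νn n s)
  set B := ∫ σ, g σ ∂(ν s); set Bn := ∫ σ, g σ ∂(νn n s)
  set P := ∫ σ, f σ * g σ ∂(ν s); set Pn := ∫ σ, f σ * g σ ∂(νn n s)
  have hA : |A| ≤ Mf := abs_integral_le_of_abs_le hMf
  have hBn : |Bn| ≤ Mg := abs_integral_le_of_abs_le hMg
  have hprod : |A * B - An * Bn| ≤ Mf * (ε / (3 * (Mf + 1))) + ε / (3 * (Mg + 1)) * Mg := by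
    calc |A * B - An * Bn| = |A * (B - Bn) + (A - An) * Bn| := by ring_nf
      _ ≤ |A * (B - Bn)| + |(A - An) * Bn| := abs_add_le _ _
      _ = |A| * |B - Bn| + |A - An| * |Bn| := by rw [abs_mul, abs_mul]
      _ ≤ Mf * (ε / (3 * (Mf + 1))) + ε / (3 * (Mg + 1)) * Mg :=
          add_le_add (mul_le_mul hA e2.le (abs_nonneg _) hMf0) (mul_le_mul e1.le hBn (abs_nonneg _) hε₁.le)
  have hb1 : Mf * (ε / (3 * (Mf + 1))) ≤ ε / 3 := by rw [← mul_div_assoc, div_le_div_iff₀ (by positivity) three_pos]; nlinarith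
  have hb2 : ε / (3 * (Mg + 1)) * Mg ≤ ε / 3 := by rw [div_mul_eq_mul_div, div_le_div_iff₀ (by positivity) three_pos]; nlinarith
  calc |P - A * B - (Pn - An * Bn)| = |(P - Pn) - (A * B - An * Bn)| := by ring_nf
    _ ≤ |P - Pn| + |A * B - An * Bn| := abs_sub _ _
    _ < ε / 3 + (ε / 3 + ε / 3) := by linarith
    _ = ε := by ring

/-! ### The derivative along a direction -/

section Derivative

variable {W V : Potential (ZdEdge d) (Matrix.specialUnitaryGroup (Fin N) ℂ)}

/-- ★ **THE STATE IS DIFFERENTIABLE ALONG EVERY DIRECTION OF THE OPEN BALL, WITH DERIVATIVE THE SUSCEPTIBILITY SERIES.**  Member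
`W ∈ Ball(a, Λ, t)`, direction `V ∈ Ball(a_V, Λ_V, t)` with Frobenius-Lipschitz witnesses `lipV` of total load `≤ L` through every link,
`a + s₀ a_V ≤ a'`, `Λ + s₀ Λ_V ≤ Λ'`, pair door `ρ' < 1` at `(a', Λ', t)`, `t > 0`; `ν(s) ∈ 𝒢(W + sV)` any selection on `|s| ≤ s₀`; `F` bounded
measurable local (on `Λ_F`) with Frobenius-Lipschitz vector `δ_F`.  Then (i) at every `|s| < s₀`:
`HasDerivAt (s ↦ ∫ F dν(s)) (−Σ'_X cov_{ν(s)}(F, V_X)) s`, and (ii) the susceptibility series `s ↦ Σ'_X cov_{ν(s)}(F, V_X)` is CONTINUOUS on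
`|s| ≤ s₀` (uniform limit of the truncated sums, each continuous by the tilt formula). -/
theorem hasDerivAt_and_continuousOn_direction_S (hd : 1 ≤ d) (hN : 1 ≤ N) {β b c v a' Λ' t : ℝ}
    (hc : 0 ≤ c) (hv : 0 ≤ v) (hb : |β| * (2 * ((d : ℝ) - 1)) ≤ b)
    (hP : ∀ B : Matrix (Fin N) (Fin N) ℂ, matrixOpNorm B ≤ b →
      ∀ (ψ : Matrix.specialUnitaryGroup (Fin N) ℂ → ℝ) (M : ℝ), 0 ≤ M →
        (∀ x y, |ψ x - ψ y| ≤ M * suFrobDist x y) →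
        Var[ψ; (haarProbability (Matrix.specialUnitaryGroup (Fin N) ℂ)).tilted
          fun g => (N : ℝ) * ((g : Matrix (Fin N) (Fin N) ℂ) * B).trace.re] ≤ c * M ^ 2)
    (hVB : ∀ B : Matrix (Fin N) (Fin N) ℂ, matrixOpNorm B ≤ b → ∀ Δ : Matrix (Fin N) (Fin N) ℂ,
      Var[fun g : Matrix.specialUnitaryGroup (Fin N) ℂ =>
          (N : ℝ) * ((g : Matrix (Fin N) (Fin N) ℂ) * Δ).trace.re;
        (haarProbability (Matrix.specialUnitaryGroup (Fin N) ℂ)).tilted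
          fun g => (N : ℝ) * ((g : Matrix (Fin N) (Fin N) ℂ) * B).trace.re] ≤ v * frobNorm Δ ^ 2)
    (ht : 0 < t) (hρ : 6 * ((d : ℝ) - 1) * |β| * (exp a' * exp t * Real.sqrt (c * v)) + exp (a' / 2) * Real.sqrt c * Λ' < 1)
    {a Λ aV ΛV s₀ : ℝ} (hW : MemBallZdS a Λ t W) (hV : MemBallZdS aV ΛV t V) (haV : 0 ≤ aV) (hΛV : 0 ≤ ΛV)
    (hs₀ : 0 < s₀) (ha' : a + s₀ * aV ≤ a') (hΛ' : Λ + s₀ * ΛV ≤ Λ')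
    {lipV : Finset (ZdEdge d) → ZdEdge d → ℝ} (hlipV : ∀ X, IsLipBound suFrobDist (V X) (lipV X)) {L : ℝ}
    (hLs : ∀ e, Summable fun X : Finset (ZdEdge d) => (if e ∈ X then ∑ y ∈ X, lipV X y else 0))
    (hL : ∀ e, ∑' X : Finset (ZdEdge d), (if e ∈ X then ∑ y ∈ X, lipV X y else 0) ≤ L)
    {ν : ℝ → Measure (LGConfig d (Matrix.specialUnitaryGroup (Fin N) ℂ))}
    (hν : ∀ s ∈ Set.Icc (-s₀) s₀, ν s ∈ perturbedGibbsMeasuresS (d := d) (fundamentalRep (Fin N)) (N * β) (W + s • V))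
    {F : LGConfig d (Matrix.specialUnitaryGroup (Fin N) ℂ) → ℝ} (hFm : Measurable F) {ΛF : Finset (ZdEdge d)}
    (hFdep : DependsOn F (↑ΛF : Set (ZdEdge d))) {MF : ℝ} (hMF : ∀ σ, |F σ| ≤ MF) {δF : ZdEdge d → ℝ}
    (hδF : IsLipBound suFrobDist F δF) :
    (∀ s ∈ Set.Ioo (-s₀) s₀, HasDerivAt (fun s => ∫ U, F U ∂(ν s)) (-(∑' X : Finset (ZdEdge d), cov[F, V X; ν s])) s) ∧
      ContinuousOn (fun s => ∑' X : Finset (ZdEdge d), cov[F, V X; ν s]) (Set.Icc (-s₀) s₀) := by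
  classical
  haveI : SecondCountableTopology (Matrix (Fin N) (Fin N) ℂ) :=
    inferInstanceAs (SecondCountableTopology (Fin N → Fin N → ℂ))
  haveI : SecondCountableTopology (Matrix.specialUnitaryGroup (Fin N) ℂ) :=
    Topology.IsEmbedding.subtypeVal.secondCountableTopology
  set I : Set ℝ := Set.Ioo (-s₀) s₀ with hI; set J : Set ℝ := Set.Icc (-s₀) s₀ with hJ
  have hII : I ⊆ J := Set.Ioo_subset_Icc_self
  have habs : ∀ {s}, s ∈ Set.Icc (-s₀) s₀ → |s| ≤ s₀ := fun hs => abs_le.2 ⟨by linarith [hs.1], hs.2⟩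
  obtain ⟨T, hT⟩ := exists_term_exhaustion d
  -- the member `W` itself: data and uniqueness at the bigger loads
  have hW' : MemBallZdS a' Λ' t W := hW.mono (by nlinarith) (by nlinarith)
  obtain ⟨BW, hBW⟩ := hW'.summable
  obtain ⟨osc, lip, ℓ, hosc, hlip, hoscs, hosca, hlips, hℓ, hℓs, hℓt⟩ := hW'.loads
  have huniq := subsingleton_perturbedGibbsMeasuresS_SU hd hN hc hv hb hP hVB hBW hW'.continuous hW'.dependsOn hosc hoscs hosca
    hlip hlips hℓ ht.le hℓs hℓt hρ
  obtain ⟨μ, hμ⟩ := perturbedGibbsMeasuresS_nonempty _ (continuous_fundamentalRep (Fin N)) _ hBW hW'.continuous hW'.dependsOn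
  have hVb : ∀ X, ∃ C, ∀ U, |V X U| ≤ C := fun X => exists_bound_of_continuous (hV.continuous X)
  set Vn : ℕ → Potential (ZdEdge d) (Matrix.specialUnitaryGroup (Fin N) ℂ) := fun n => (↑(T n) : Set (Finset (ZdEdge d))).indicator V
    with hVn
  have hVnc : ∀ n X, Continuous (Vn n X) := fun n X => continuous_indicator_apply hV.continuous X
  have hVndep : ∀ n X, DependsOn (Vn n X) (↑X : Set (ZdEdge d)) := fun n X => dependsOn_indicator_apply hV.dependsOn X
  have hVnsupp : ∀ n, (Vn n).IsSupportedBy fun _ => T n := fun n => isSupportedBy_indicator (T n) V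
  set νn : ℕ → ℝ → Measure (LGConfig d (Matrix.specialUnitaryGroup (Fin N) ℂ)) :=
    fun n s => μ.tilted fun U => -s * ∑ A ∈ T n, Vn n A U with hνn_def
  have hνn : ∀ n s, νn n s ∈ perturbedGibbsMeasuresS (d := d) (fundamentalRep (Fin N)) (N * β) (W + s • Vn n) := fun n s => by
    rw [perturbedGibbsMeasuresS_add_smul_eq_singleton (fundamentalRep (Fin N)) (continuous_fundamentalRep (Fin N)) (N * β) hBW
      hW'.continuous hW'.dependsOn (hVnc n) (hVndep n) (hVnsupp n) (fun _ => subset_rfl) huniq hμ s]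
    exact Set.mem_singleton _
  have hprob_n : ∀ n s, IsProbabilityMeasure (νn n s) := fun n s => (show IsGibbsMeasure _ _ from hνn n s).isProbabilityMeasure
  have hprob : ∀ s ∈ J, IsProbabilityMeasure (ν s) := fun s hs => (show IsGibbsMeasure _ _ from hν s hs).isProbabilityMeasure
  -- (a) Feynman–Hellmann along the truncated lines
  have hderiv : ∀ n, ∀ s ∈ I, HasDerivAt (fun s => ∫ U, F U ∂(νn n s)) (-(∑ X ∈ T n, cov[F, V X; νn n s])) s := by
    intro n s _
    have h := (hasDerivAt_integral_of_mem_perturbedGibbsMeasuresS_add_smul (fundamentalRep (Fin N))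
      (continuous_fundamentalRep (Fin N)) (N * β) hBW hW'.continuous hW'.dependsOn (hVnc n) (hVndep n) (hVnsupp n)
      (fun _ => subset_rfl) huniq hμ (hνn n) hFm hMF s).2
    haveI := hprob_n n s
    have hF2 : MemLp F 2 (νn n s) := MemLp.of_bound hFm.aestronglyMeasurable MF (Eventually.of_forall fun σ => by
      rw [Real.norm_eq_abs]; exact hMF σ)
    have hV2 : ∀ A ∈ T n, MemLp (fun U => Vn n A U) 2 (νn n s) := fun A _ => by
      obtain ⟨C, hC⟩ := exists_bound_of_continuous (hVnc n A)
      exact MemLp.of_bound (hVnc n A).measurable.aestronglyMeasurable C (Eventually.of_forall fun σ => by rw [Real.norm_eq_abs]; exact hC σ)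
    have hcov : cov[F, fun U => ∑ A ∈ T n, Vn n A U; νn n s] = ∑ X ∈ T n, cov[F, V X; νn n s] := by
      rw [covariance_fun_sum_right' hV2 hF2]
      refine sum_congr rfl fun X hX => ?_
      simp only [hVn, Set.indicator_of_mem (Finset.mem_coe.2 hX)]
    rwa [hcov] at h
  -- (b) uniform convergence of expectations along the truncations (screened stability)
  have hunif : ∀ {g : LGConfig d (Matrix.specialUnitaryGroup (Fin N) ℂ) → ℝ} {Δ : Finset (ZdEdge d)} {M : ℝ} {δ : ZdEdge d → ℝ},
      Measurable g → DependsOn g (↑Δ : Set (ZdEdge d)) → (∀ σ, |g σ| ≤ M) → IsLipBound suFrobDist g δ →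
      TendstoUniformlyOn (fun n s => ∫ σ, g σ ∂(νn n s)) (fun s => ∫ σ, g σ ∂(ν s)) atTop J :=
    fun hgm hgdep hM hδ => tendstoUniformlyOn_integral_truncation_S hd hN hc hv hb hP hVB ht hρ hW hV haV hΛV hs₀.le ha' hΛ' hT
      (fun n s _ => hνn n s) hν hgm hgdep hM hδ
  -- (c) one summable majorant for all covariances of all states of all members of `Ball(a', Λ', t)`
  set A₀ : ℝ := 2 * (2 * Real.sqrt N) ^ 2 * ∑ y ∈ ΛF, δF y with hA₀
  set LX : Finset (ZdEdge d) → ℝ := fun X => ∑ y ∈ X, lipV X y with hLX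
  set g₀ : ZdEdge d → ℝ := fun e => exp (-t * linkSetDist ΛF e) with hg₀
  set Φ : Finset (ZdEdge d) → ℝ := fun X => A₀ * LX X * ∑ e ∈ X, g₀ e with hΦ
  have hδ0 : 0 ≤ ∑ y ∈ ΛF, δF y := sum_nonneg fun y _ => hδF.nonneg y
  have hA₀0 : 0 ≤ A₀ := by positivity
  have hLX0 : ∀ X, 0 ≤ LX X := fun X => sum_nonneg fun y _ => (hlipV X).nonneg y; have hg₀0 : ∀ e, 0 ≤ g₀ e := fun e => (exp_pos _).le
  have hΦ0 : ∀ X, 0 ≤ Φ X := fun X => mul_nonneg (mul_nonneg hA₀0 (hLX0 X)) (sum_nonneg fun e _ => hg₀0 e)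
  have hd0 : 0 < d := hd
  have hL0 : 0 ≤ L := le_trans (tsum_nonneg fun X => by split_ifs; exacts [hLX0 X, le_rfl]) (hL (0, ⟨0, hd0⟩))
  have hΦs : Summable Φ := by
    refine summable_of_sum_le hΦ0 (c := A₀ * L * (ΛF.card * (d * ((1 + exp (-(t / d))) / (1 - exp (-(t / d)))) ^ d)))
      fun Tf => ?_
    have h1 : ∑ X ∈ Tf, Φ X = A₀ * ∑ X ∈ Tf, LX X * ∑ e ∈ X, g₀ e := by rw [mul_sum]; exact sum_congr rfl fun X _ => by ring
    rw [h1]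
    by_cases hΛF : ΛF.Nonempty
    · obtain ⟨hgs, hgt⟩ := summable_exp_neg_linkSetDist hd ht hΛF
      calc A₀ * ∑ X ∈ Tf, LX X * ∑ e ∈ X, g₀ e
          ≤ A₀ * (L * (ΛF.card * (d * ((1 + exp (-(t / d))) / (1 - exp (-(t / d)))) ^ d))) :=
            mul_le_mul_of_nonneg_left ((sum_mul_sum_le_of_load hg₀0 hgs hLX0 hL0 hLs hL).trans
              (mul_le_mul_of_nonneg_left hgt hL0)) hA₀0
        _ = _ := by ring
    · simp [hA₀, Finset.not_nonempty_iff_eq_empty.1 hΛF]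
  have hbound : ∀ {W' : Potential (ZdEdge d) (Matrix.specialUnitaryGroup (Fin N) ℂ)}, MemBallZdS a' Λ' t W' →
      ∀ {μ' : Measure (LGConfig d (Matrix.specialUnitaryGroup (Fin N) ℂ))},
        μ' ∈ perturbedGibbsMeasuresS (d := d) (fundamentalRep (Fin N)) (N * β) W' → ∀ X, |cov[F, V X; μ']| ≤ Φ X := by
    intro W' hW'' μ' hμ' X
    obtain ⟨B', hB'⟩ := hW''.summable
    obtain ⟨osc', lip', ℓ', hosc', hlip', hoscs', hosca', hlips', hℓ', hℓs', hℓt'⟩ := hW''.loads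
    obtain ⟨CX, hCX⟩ := hVb X
    have h1 := abs_cov_le_of_isLipBound_S hd hN hc hv hb hP hVB hB' hW''.continuous hW''.dependsOn hosc' hoscs' hosca' hlip' hlips'
      hℓ' ht.le hℓs' hℓt' hρ hμ' hFm hFdep hMF hδF (hV.continuous X).measurable (hV.dependsOn X) hCX (hlipV X)
    refine le_mul_sum_exp_of_le_mul_exp ht.le hA₀0 (hLX0 X) ?_ (fun hX => ?_) (fun hΔ => ?_)
    · simpa only [hA₀, hLX, mul_assoc, mul_comm, mul_left_comm] using h1
    · simp only [hLX, Finset.not_nonempty_iff_eq_empty.1 hX, sum_empty]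
    · simp only [hA₀, Finset.not_nonempty_iff_eq_empty.1 hΔ, sum_empty, mul_zero]
  have hc' : ∀ n, ∀ s ∈ J, ∀ X, |cov[F, V X; νn n s]| ≤ Φ X := fun n s hs X =>
    hbound (memBallZdS_add_smul_indicator hW hV haV hΛV ha' hΛ' (habs hs) _) (hνn n s) X
  have hcinf : ∀ s ∈ J, ∀ X, |cov[F, V X; ν s]| ≤ Φ X := fun s hs X => by
    have hm := memBallZdS_add_smul_indicator hW hV haV hΛV ha' hΛ' (habs hs) Set.univ
    rw [Set.indicator_univ] at hm
    exact hbound hm (hν s hs) X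
  -- (d) termwise uniform convergence of the covariances
  have hMF0 : 0 ≤ MF := (abs_nonneg _).trans (hMF fun _ => 1)
  have hconv : ∀ X, TendstoUniformlyOn (fun n s => cov[F, V X; νn n s]) (fun s => cov[F, V X; ν s]) atTop J := by
    intro X
    obtain ⟨CX, hCX⟩ := hVb X
    have hCX0 : 0 ≤ CX := (abs_nonneg _).trans (hCX fun _ => 1)
    exact tendstoUniformlyOn_cov (fun n s _ => hprob_n n s) (fun s hs => hprob s hs) hFm (hV.continuous X).measurable hMF0 hCX0
      hMF hCX (hunif hFm hFdep hMF hδF) (hunif (hV.continuous X).measurable (hV.dependsOn X) hCX (hlipV X))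
      (hunif (hFm.mul (hV.continuous X).measurable) (dependsOn_mul_union hFdep (hV.dependsOn X))
        (fun σ => by rw [abs_mul]; exact mul_le_mul (hMF σ) (hCX σ) (abs_nonneg _) hMF0)
        (isLipBound_mul_of_abs_le (fun _ _ => suFrobDist_nonneg _ _) hMF0 hCX0 hMF hCX hδF (hlipV X)))
  -- (e) each truncated susceptibility sum is continuous in `s` (tilt formula), hence so is the uniform limit
  have hcont : ∀ n, ContinuousOn (fun s => ∑ X ∈ T n, cov[F, V X; νn n s]) J := by
    intro n
    choose CA hCA using fun A => exists_bound_of_continuous (hVnc n A)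
    have hHm : Measurable fun U : LGConfig d (Matrix.specialUnitaryGroup (Fin N) ℂ) => ∑ A ∈ T n, Vn n A U :=
      Finset.measurable_sum _ fun A _ => (hVnc n A).measurable
    have hHb : ∀ U : LGConfig d (Matrix.specialUnitaryGroup (Fin N) ℂ), |∑ A ∈ T n, Vn n A U| ≤ ∑ A ∈ T n, CA A := fun U =>
      (Finset.abs_sum_le_sum_abs _ _).trans (Finset.sum_le_sum fun A _ => hCA A U)
    haveI := (show IsGibbsMeasure _ μ from hμ).isProbabilityMeasure
    have hint : ∀ {g : LGConfig d (Matrix.specialUnitaryGroup (Fin N) ℂ) → ℝ} {M : ℝ}, Measurable g → (∀ σ, |g σ| ≤ M) →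
        Continuous fun s => ∫ σ, g σ ∂(νn n s) := fun hgm hM =>
      continuous_iff_continuousAt.2 fun s =>
        (hasDerivAt_integral_tilted_of_bounded (μ := μ) hHm hHb hgm.aestronglyMeasurable hM s).continuousAt
    refine continuousOn_finsetSum _ fun X _ => Continuous.continuousOn ?_
    obtain ⟨CX, hCX⟩ := hVb X
    have hF2 : ∀ s, MemLp F 2 (νn n s) := fun s =>
      MemLp.of_bound hFm.aestronglyMeasurable MF (Eventually.of_forall fun σ => by rw [Real.norm_eq_abs]; exact hMF σ)
    have hV2 : ∀ s, MemLp (V X) 2 (νn n s) := fun s => MemLp.of_bound (hV.continuous X).measurable.aestronglyMeasurable CX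
      (Eventually.of_forall fun σ => by rw [Real.norm_eq_abs]; exact hCX σ)
    have heq : (fun s => cov[F, V X; νn n s]) =
        fun s => (∫ σ, F σ * V X σ ∂(νn n s)) - (∫ σ, F σ ∂(νn n s)) * ∫ σ, V X σ ∂(νn n s) :=
      funext fun s => by rw [covariance_eq_sub (hF2 s) (hV2 s)]; rfl
    rw [heq]
    exact (hint (g := fun σ => F σ * V X σ) (hFm.mul (hV.continuous X).measurable) (M := MF * CX)
      (fun σ => by rw [abs_mul]; exact mul_le_mul (hMF σ) (hCX σ) (abs_nonneg _) hMF0)).sub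
      ((hint hFm hMF).mul (hint (hV.continuous X).measurable hCX))
  have hU := tendstoUniformlyOn_finsetSum_tsum hT hΦ0 hΦs hc' hcinf hconv
  -- (f) assemble
  exact ⟨fun s hs => hasDerivAt_of_truncations hT hΦ0 hΦs isOpen_Ioo (fun n s hs X => hc' n s (hII hs) X)
      (fun s hs X => hcinf s (hII hs) X) (fun X => (hconv X).mono hII) hderiv
      (fun s hs => (hunif hFm hFdep hMF hδF).tendsto_at (hII hs)) hs,
    hU.continuousOn (Eventually.of_forall hcont).frequently⟩

/-- ★ **THE STATE IS `C¹` ALONG EVERY DIRECTION OF THE OPEN BALL**: under the same hypotheses `s ↦ ∫ F dν(s)` is `ContDiffOn ℝ 1` on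
`(−s₀, s₀)` (derivative formula (i) + continuity (ii) of `hasDerivAt_and_continuousOn_direction_S`). -/
theorem contDiffOn_integral_direction_S (hd : 1 ≤ d) (hN : 1 ≤ N) {β b c v a' Λ' t : ℝ}
    (hc : 0 ≤ c) (hv : 0 ≤ v) (hb : |β| * (2 * ((d : ℝ) - 1)) ≤ b)
    (hP : ∀ B : Matrix (Fin N) (Fin N) ℂ, matrixOpNorm B ≤ b →
      ∀ (ψ : Matrix.specialUnitaryGroup (Fin N) ℂ → ℝ) (M : ℝ), 0 ≤ M →
        (∀ x y, |ψ x - ψ y| ≤ M * suFrobDist x y) →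
        Var[ψ; (haarProbability (Matrix.specialUnitaryGroup (Fin N) ℂ)).tilted
          fun g => (N : ℝ) * ((g : Matrix (Fin N) (Fin N) ℂ) * B).trace.re] ≤ c * M ^ 2)
    (hVB : ∀ B : Matrix (Fin N) (Fin N) ℂ, matrixOpNorm B ≤ b → ∀ Δ : Matrix (Fin N) (Fin N) ℂ,
      Var[fun g : Matrix.specialUnitaryGroup (Fin N) ℂ =>
          (N : ℝ) * ((g : Matrix (Fin N) (Fin N) ℂ) * Δ).trace.re;
        (haarProbability (Matrix.specialUnitaryGroup (Fin N) ℂ)).tilted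
          fun g => (N : ℝ) * ((g : Matrix (Fin N) (Fin N) ℂ) * B).trace.re] ≤ v * frobNorm Δ ^ 2)
    (ht : 0 < t) (hρ : 6 * ((d : ℝ) - 1) * |β| * (exp a' * exp t * Real.sqrt (c * v)) + exp (a' / 2) * Real.sqrt c * Λ' < 1)
    {a Λ aV ΛV s₀ : ℝ} (hW : MemBallZdS a Λ t W) (hV : MemBallZdS aV ΛV t V) (haV : 0 ≤ aV) (hΛV : 0 ≤ ΛV)
    (hs₀ : 0 < s₀) (ha' : a + s₀ * aV ≤ a') (hΛ' : Λ + s₀ * ΛV ≤ Λ')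
    {lipV : Finset (ZdEdge d) → ZdEdge d → ℝ} (hlipV : ∀ X, IsLipBound suFrobDist (V X) (lipV X)) {L : ℝ}
    (hLs : ∀ e, Summable fun X : Finset (ZdEdge d) => (if e ∈ X then ∑ y ∈ X, lipV X y else 0))
    (hL : ∀ e, ∑' X : Finset (ZdEdge d), (if e ∈ X then ∑ y ∈ X, lipV X y else 0) ≤ L)
    {ν : ℝ → Measure (LGConfig d (Matrix.specialUnitaryGroup (Fin N) ℂ))}
    (hν : ∀ s ∈ Set.Icc (-s₀) s₀, ν s ∈ perturbedGibbsMeasuresS (d := d) (fundamentalRep (Fin N)) (N * β) (W + s • V))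
    {F : LGConfig d (Matrix.specialUnitaryGroup (Fin N) ℂ) → ℝ} (hFm : Measurable F) {ΛF : Finset (ZdEdge d)}
    (hFdep : DependsOn F (↑ΛF : Set (ZdEdge d))) {MF : ℝ} (hMF : ∀ σ, |F σ| ≤ MF) {δF : ZdEdge d → ℝ}
    (hδF : IsLipBound suFrobDist F δF) :
    ContDiffOn ℝ 1 (fun s => ∫ U, F U ∂(ν s)) (Set.Ioo (-s₀) s₀) := by
  obtain ⟨h1, h2⟩ := hasDerivAt_and_continuousOn_direction_S hd hN hc hv hb hP hVB ht hρ hW hV haV hΛV hs₀ ha' hΛ' hlipV hLs hL hν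
    hFm hFdep hMF hδF
  exact Summit.Ventures.YMGap.CouplingResponse.contDiffOn_one_of_hasDerivAt h1 h2.neg

end Derivative

/-! ### `SU(2)`, `ℤ⁴`, hypothesis-free -/

/-- **`SU(2)`, `ℤ⁴` — THE STATE IS DIFFERENTIABLE ALONG EVERY DIRECTION OF THE OPEN WEIGHTED BALL, derivative = the susceptibility series.**
`0 < t`, `0 < s₀`, `6|β_W| e^{a'} e^{t} + e^{a'/2} √(2/3) Λ' < 1`, `W ∈ MemBallZdS a Λ t`, `V ∈ MemBallZdS a_V Λ_V t` with Frobenius-Lipschitz witnesses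
of total load `≤ L` through every link, `a + s₀ a_V ≤ a'`, `Λ + s₀ Λ_V ≤ Λ'` (bare coupling `β_W/2`): for every selection `ν(s) ∈ 𝒢(W + sV)` on
`|s| ≤ s₀` and every Lipschitz cylinder `F`: `HasDerivAt (s ↦ ∫ F dν(s)) (−Σ'_X cov_{ν(s)}(F, V_X)) s` at every `|s| < s₀`, AND `s ↦ ∫ F dν(s)` is
`ContDiffOn ℝ 1` on `(−s₀, s₀)`. -/
theorem su2_hasDerivAt_integral_direction_dim4 {βW a' Λ' t a Λ aV ΛV s₀ : ℝ} (ht : 0 < t) (hs₀ : 0 < s₀)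
    (hρ : 6 * |βW| * (exp a' * exp t) + exp (a' / 2) * Real.sqrt (2 / 3) * Λ' < 1)
    {W V : Potential (ZdEdge 4) (Matrix.specialUnitaryGroup (Fin 2) ℂ)} (hW : MemBallZdS a Λ t W) (hV : MemBallZdS aV ΛV t V)
    (haV : 0 ≤ aV) (hΛV : 0 ≤ ΛV) (ha' : a + s₀ * aV ≤ a') (hΛ' : Λ + s₀ * ΛV ≤ Λ')
    {lipV : Finset (ZdEdge 4) → ZdEdge 4 → ℝ} (hlipV : ∀ X, IsLipBound suFrobDist (V X) (lipV X)) {L : ℝ}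
    (hLs : ∀ e, Summable fun X : Finset (ZdEdge 4) => (if e ∈ X then ∑ y ∈ X, lipV X y else 0))
    (hL : ∀ e, ∑' X : Finset (ZdEdge 4), (if e ∈ X then ∑ y ∈ X, lipV X y else 0) ≤ L)
    {ν : ℝ → Measure (LGConfig 4 (Matrix.specialUnitaryGroup (Fin 2) ℂ))}
    (hν : ∀ s ∈ Set.Icc (-s₀) s₀, ν s ∈ perturbedGibbsMeasuresS (d := 4) (fundamentalRep (Fin 2)) (2 * (βW / 4)) (W + s • V))
    {F : LGConfig 4 (Matrix.specialUnitaryGroup (Fin 2) ℂ) → ℝ} {ΛF : Finset (ZdEdge 4)} {KF : ℝ≥0}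
    (hF : IsLipschitzCylinder (fundamentalRep (Fin 2)) F ΛF KF) :
    (∀ s ∈ Set.Ioo (-s₀) s₀, HasDerivAt (fun s => ∫ U, F U ∂(ν s)) (-(∑' X : Finset (ZdEdge 4), cov[F, V X; ν s])) s) ∧
      ContDiffOn ℝ 1 (fun s => ∫ U, F U ∂(ν s)) (Set.Ioo (-s₀) s₀) := by
  have hc : (0 : ℝ) ≤ 2 / 3 := by norm_num
  have hP : ∀ B : Matrix (Fin 2) (Fin 2) ℂ, matrixOpNorm B ≤ |βW / 4| * (2 * (((4 : ℕ) : ℝ) - 1)) →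
      ∀ (ψ : Matrix.specialUnitaryGroup (Fin 2) ℂ → ℝ) (M : ℝ), 0 ≤ M →
        (∀ x y, |ψ x - ψ y| ≤ M * suFrobDist x y) →
        Var[ψ; (haarProbability (Matrix.specialUnitaryGroup (Fin 2) ℂ)).tilted
          fun g => ((2 : ℕ) : ℝ) * ((g : Matrix (Fin 2) (Fin 2) ℂ) * B).trace.re] ≤ 2 / 3 * M ^ 2 :=
    fun B hB ψ M hM hψ => oneLinkPoincareSUN_two_sharp _ B hB ψ M hM hψ
  have hVB := linVariance_of_poincare (N := 2) hP
  have hv : (0 : ℝ) ≤ 2 / 3 * ((2 : ℕ) : ℝ) ^ 2 := by norm_num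
  have hsq : Real.sqrt (2 / 3 * (2 / 3 * ((2 : ℕ) : ℝ) ^ 2)) = 4 / 3 := by
    rw [show (2 / 3 * (2 / 3 * ((2 : ℕ) : ℝ) ^ 2) : ℝ) = (4 / 3) ^ 2 by norm_num, Real.sqrt_sq (by norm_num)]
  have hρ' : 6 * (((4 : ℕ) : ℝ) - 1) * |βW / 4| * (exp a' * exp t * Real.sqrt (2 / 3 * (2 / 3 * ((2 : ℕ) : ℝ) ^ 2))) +
      exp (a' / 2) * Real.sqrt (2 / 3) * Λ' < 1 := by
    rw [hsq, abs_div, abs_of_pos (by norm_num : (0 : ℝ) < 4)]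
    have : 6 * (((4 : ℕ) : ℝ) - 1) * (|βW| / 4) * (exp a' * exp t * (4 / 3)) = 6 * |βW| * (exp a' * exp t) := by norm_num; ring
    rw [this]; exact hρ
  have hν' : ∀ s ∈ Set.Icc (-s₀) s₀, ν s ∈ perturbedGibbsMeasuresS (d := 4) (fundamentalRep (Fin 2)) ((2 : ℕ) * (βW / 4)) (W + s • V) :=
    fun s hs => by simpa using hν s hs
  have hA : ∀ a b : Matrix.specialUnitaryGroup (Fin 2) ℂ, dist (suEntries a) (suEntries b) ≤ 1 * suFrobDist a b :=
    fun a b => by rw [one_mul]; exact dist_suEntries_le_suFrobDist a b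
  have key := hasDerivAt_and_continuousOn_direction_S (N := 2) (d := 4) (by norm_num) (by norm_num) hc hv le_rfl hP hVB ht hρ' hW
    hV haV hΛV hs₀ ha' hΛ' hlipV hLs hL hν' hF.measurable hF.dependsOn hF.abs_le (hF.isLipBound zero_le_one hA)
  exact ⟨key.1, Summit.Ventures.YMGap.CouplingResponse.contDiffOn_one_of_hasDerivAt key.1 key.2.neg⟩

/-- **THE `SU(2)` WILSON POINT ON `ℤ⁴` IS DIFFERENTIABLE IN EVERY DIRECTION OF THE WEIGHTED BALL.**  `0 < t`, `0 < s₀`, direction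
`V ∈ MemBallZdS a_V Λ_V t` (Lipschitz load `≤ L`) with `6|β_W| e^{s₀ a_V} e^{t} + e^{s₀ a_V/2} √(2/3) s₀ Λ_V < 1`: for every selection
`ν(s) ∈ 𝒢(Wilson + sV)`, `|s| ≤ s₀` (`ν(0)` = THE Wilson state), every Lipschitz cylinder `F`: `d/ds ∫ F dν(s) = −Σ'_X cov_{ν(s)}(F, V_X)`
at every `|s| < s₀` — in particular AT the Wilson point (`s = 0`) — and `s ↦ ∫ F dν(s)` is `C¹` on `(−s₀, s₀)`. -/
theorem su2_wilson_hasDerivAt_integral_direction {βW t aV ΛV s₀ : ℝ} (ht : 0 < t) (hs₀ : 0 < s₀)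
    (hρ : 6 * |βW| * (exp (s₀ * aV) * exp t) + exp (s₀ * aV / 2) * Real.sqrt (2 / 3) * (s₀ * ΛV) < 1)
    {V : Potential (ZdEdge 4) (Matrix.specialUnitaryGroup (Fin 2) ℂ)} (hV : MemBallZdS aV ΛV t V) (haV : 0 ≤ aV) (hΛV : 0 ≤ ΛV)
    {lipV : Finset (ZdEdge 4) → ZdEdge 4 → ℝ} (hlipV : ∀ X, IsLipBound suFrobDist (V X) (lipV X)) {L : ℝ}
    (hLs : ∀ e, Summable fun X : Finset (ZdEdge 4) => (if e ∈ X then ∑ y ∈ X, lipV X y else 0))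
    (hL : ∀ e, ∑' X : Finset (ZdEdge 4), (if e ∈ X then ∑ y ∈ X, lipV X y else 0) ≤ L)
    {ν : ℝ → Measure (LGConfig 4 (Matrix.specialUnitaryGroup (Fin 2) ℂ))}
    (hν : ∀ s ∈ Set.Icc (-s₀) s₀, ν s ∈ perturbedGibbsMeasuresS (d := 4) (fundamentalRep (Fin 2)) (2 * (βW / 4)) (0 + s • V))
    {F : LGConfig 4 (Matrix.specialUnitaryGroup (Fin 2) ℂ) → ℝ} {ΛF : Finset (ZdEdge 4)} {KF : ℝ≥0}
    (hF : IsLipschitzCylinder (fundamentalRep (Fin 2)) F ΛF KF) :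
    (∀ s ∈ Set.Ioo (-s₀) s₀, HasDerivAt (fun s => ∫ U, F U ∂(ν s)) (-(∑' X : Finset (ZdEdge 4), cov[F, V X; ν s])) s) ∧
      ContDiffOn ℝ 1 (fun s => ∫ U, F U ∂(ν s)) (Set.Ioo (-s₀) s₀) :=
  su2_hasDerivAt_integral_direction_dim4 (a := 0) (Λ := 0) ht hs₀ (by simpa using hρ) (memBallZdS_zero le_rfl le_rfl) hV haV hΛV
    (by simp) (by simp) hlipV hLs hL hν hF

end Summit.Ventures.YMGap.RobustBall

end
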